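import Summits.Langlands.Langlands.Theorems.IrreducibilityBySelfDualityIrreducibleOffSectorRegularAttached
import HarnessLib

/-!
# Regular L-algebraic cuspidal `π` are L-arithmetic, in every rank
(crux stmt-Langlands-14329 `IrreducibilityBySelfDuality.IrreducibleOffSector`, line `Sketch`;
`--supports` file, lead c8 CONSTITUENT package)

The constituent-level package of the crux ("cuspidal ⇒ every almost-everywhere compatible `ℓ`-adic
`ρ` is irreducible") needs the compatible `ρ` to be `E`-rational for a number field `E`, which the
tree (`eventually_rational_of_esymm_mem`) deduces from **L-arithmeticity** of `π`: the elementary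
symmetric functions `e_i(t_{π,v})` of the unitary-normalised Satake parameters lie in a fixed
subfield `E ⊆ ℂ`, finite over `ℚ`, for almost all `v` (Buzzard–Gee 2014, Def. 3.1.4).  Here we prove
this for every cuspidal `π` on `GL_n(𝔸_K)`, `n ≥ 1`, that is L-algebraic with a REGULAR infinity type,
granting Clozel's theorem (Clozel 1990, Thm. 3.13 / Déf. 3.12, the text of the route input
`HeckeEigenvalueField`): for a REGULAR ALGEBRAIC cuspidal `π'` there is a number field `E ⊆ ℂ` with
`(√q_v)^{i(n-i)} e_i(β_v) ∈ E` for every Satake parameter `β_v` of `π'` at almost every `v`.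
The argument is the half-twist of Buzzard–Gee §5.3: `π' := π ⊗ |det|^{(n-1)/2}` is regular
algebraic (`isRegularAlgebraic_of_hasInfinityType_twist_half`); if `β` is the Satake parameter of
`π'` at `v` then `π` has Satake parameter `α = q_v^{(n-1)/2} β` (`hasSatakeParamAt_map_cpow_of_twist`),
so `e_i(α) = (√q_v)^{i(n-1)} e_i(β) = q_v^{i(i-1)/2} · (√q_v)^{i(n-i)} e_i(β) ∈ E`, because
`i(n-1) = i(n-i) + i(i-1)`, `i(i-1)` is even and `ℚ ⊆ E`.

References: L. Clozel, *Motifs et formes automorphes: applications du principe de fonctorialité*,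
Perspect. Math. 10 (1990), Thm. 3.13 and Déf. 3.12; K. Buzzard, T. Gee, *The conjectural
connections between automorphic representations and Galois representations*, LMS LNS 414 (2014),
§5.3 and Def. 3.1.4.
-/

noncomputable section

set_option linter.dupNamespace false

open scoped NumberField Classical
open Filter IsDedekindDomain NumberField
open Literature.NumberTheory.Automorphic Literature.NumberTheory.GaloisRepresentations
open Summit.Langlands

namespace Summit.Langlands.Langlands.Theorems.IrreducibleOffSector

/-! ### Bookkeeping: the half-twist exponent in rank `n` -/

/-- The half-twist exponent for `GL_n`, `n ≥ 1`: `q^{(n-1)/2} = (√q)^{n-1}` in `ℂ`. [folklore] -/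
theorem natCast_cpow_half_eq_sqrt_pow {n : ℕ} (hn : 1 ≤ n) (q : ℕ) :
    (q : ℂ) ^ ((((n : ℝ) - 1) / 2 : ℝ) : ℂ) = ((Real.sqrt q : ℝ) : ℂ) ^ (n - 1) := by
  have h : (((n : ℝ) - 1) / 2 : ℝ) = (1 / 2 : ℝ) * ((n - 1 : ℕ) : ℝ) := by
    rw [Nat.cast_sub hn]; push_cast; ring
  rw [h, show (q : ℂ) = ((q : ℝ) : ℂ) by norm_cast, ← Complex.ofReal_cpow (Nat.cast_nonneg q),
    Real.rpow_mul (Nat.cast_nonneg q), Real.rpow_natCast, ← Real.sqrt_eq_rpow, Complex.ofReal_pow]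

/-- `(√q)² = q` in `ℂ`. [folklore] -/
theorem ofReal_sqrt_natCast_sq (q : ℕ) : ((Real.sqrt q : ℝ) : ℂ) ^ 2 = (q : ℂ) := by
  rw [← Complex.ofReal_pow, Real.sq_sqrt (Nat.cast_nonneg q), Complex.ofReal_natCast]

/-- Exponent bookkeeping in `ℕ`: `i (n - 1) = i (n - i) + i (i - 1)` for `i ≤ n`. [folklore] -/
theorem mul_pred_eq_mul_sub_add_mul_pred {i n : ℕ} (hi : i ≤ n) :
    i * (n - 1) = i * (n - i) + i * (i - 1) := by
  rcases Nat.eq_zero_or_pos i with rfl | hi0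
  · simp
  · have hi1 : 1 ≤ i := hi0
    have hn1 : 1 ≤ n := le_trans hi1 hi
    zify [hi, hi1, hn1]
    ring

/-- **Untwisting Clozel's integrality normalisation.**  For a subfield `E ⊆ ℂ`, `q : ℕ`, `1 ≤ n` and
`i ≤ n`: if `(√q)^{i(n-i)} e_i(β) ∈ E` then
`e_i(q^{(n-1)/2} β) = (√q)^{i(n-1)} e_i(β) = q^{i(i-1)/2} · (√q)^{i(n-i)} e_i(β) ∈ E`
(`i(i-1)` is even and `q ∈ E`). [folklore] -/
theorem esymm_map_cpow_half_mem (E : Subfield ℂ) {q n i : ℕ} (hn : 1 ≤ n) (hi : i ≤ n)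
    {β : Multiset ℂ} (h : ((Real.sqrt q : ℝ) : ℂ) ^ (i * (n - i)) * β.esymm i ∈ E) :
    (β.map (((q : ℂ) ^ ((((n : ℝ) - 1) / 2 : ℝ) : ℂ)) * ·)).esymm i ∈ E := by
  rw [esymm_map_const_mul, natCast_cpow_half_eq_sqrt_pow hn, ← pow_mul',
    mul_pred_eq_mul_sub_add_mul_pred hi, pow_add, mul_right_comm]
  obtain ⟨k, hk⟩ := Nat.even_mul_pred_self i
  rw [hk, ← two_mul, pow_mul _ 2 k, ofReal_sqrt_natCast_sq]
  exact mul_mem h (pow_mem (natCast_mem E q) k)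

/-! ### L-arithmeticity of regular L-algebraic cuspidal representations -/

/-- **Regular L-algebraic cuspidal `π` are L-arithmetic, in every rank** (granted Clozel's theorem
for regular algebraic `π'`, the hypothesis `hHE`).  Let `π` be cuspidal on `GL_n(𝔸_K)`, `n ≥ 1`,
L-algebraic with a regular infinity type.  Then there is a subfield `E ⊆ ℂ`, finite over `ℚ`, such
that for almost every finite place `v` and every Satake parameter `α` of `π` at `v`,
`e_i(α) ∈ E` for all `i ≤ n`.  Proof: the half-twist `π' = π ⊗ |det|^{(n-1)/2}` is regular algebraic
(`exists_twist_hasInfinityType`, `isRegularAlgebraic_of_hasInfinityType_twist_half`); take Clozel's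
field `E` of `π'`; at almost every `v`, `π'` has a Satake parameter `β` (Flath) with
`(√q_v)^{i(n-i)} e_i(β) ∈ E`, `π` has Satake parameter `q_v^{(n-1)/2} β`
(`hasSatakeParamAt_map_cpow_of_twist`, uniqueness of Satake parameters), and
`e_i(q_v^{(n-1)/2} β) = q_v^{i(i-1)/2} (√q_v)^{i(n-i)} e_i(β) ∈ E` (`esymm_map_cpow_half_mem`).
[cite: BuzzardGeeLMS2014, §5.3] [cite: Clozel1990, Thm. 3.13] -/
theorem exists_heckeField_of_isLAlgebraic_of_isRegular
    (hHE : ∀ (n : ℕ) (K : Type) [Field K] [NumberField K] (hcpt : Literature.NumberTheory.Automorphic.isCompact_glFiniteIntegralLevel n K) (π : Literature.NumberTheory.Automorphic.CuspidalAutomorphicRepData n K hcpt), π.1.IsRegularAlgebraic → ∃ E : Subfield ℂ, FiniteDimensional ℚ E ∧ ∀ᶠ v in cofinite, ∀ α : Multiset ℂ, π.1.HasSatakeParamAt v α → ∀ i ≤ n, ((((Real.sqrt (v.residueCard : ℝ)) : ℝ) : ℂ) ^ (i * (n - i))) * α.esymm i ∈ E)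
    {n : ℕ} [NeZero n] {K : Type} [Field K] [NumberField K] {hcpt : isCompact_glFiniteIntegralLevel n K}
    (π : CuspidalAutomorphicRepData n K hcpt) (hL : π.1.IsLAlgebraic)
    (hreg : ∃ T : InfinityType K n, π.1.HasInfinityType T ∧ T.IsRegular) :
    ∃ E : Subfield ℂ, FiniteDimensional ℚ E ∧
      ∀ᶠ v : HeightOneSpectrum (𝓞 K) in cofinite, ∀ α : Multiset ℂ, π.1.HasSatakeParamAt v α →
        ∀ i ≤ n, α.esymm i ∈ E := by
  obtain ⟨T, hT, hTL, hTR⟩ := exists_infinityType_isLAlgebraic_isRegular π.1 hL hreg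
  -- the regular algebraic twist `π' = π ⊗ |det|^{(n-1)/2}`
  obtain ⟨χ, π', hχ, hW, hW', hT'⟩ := π.exists_twist_hasInfinityType (((n : ℝ) - 1) / 2) hT
  have hRA : π'.1.IsRegularAlgebraic :=
    isRegularAlgebraic_of_hasInfinityType_twist_half (by exact_mod_cast hT') hTL hTR
  -- Clozel's number field of the regular algebraic `π'`
  obtain ⟨E, hfd, hE⟩ := hHE n K hcpt π' hRA
  refine ⟨E, hfd, ?_⟩
  have hcof : ∀ᶠ v : HeightOneSpectrum (𝓞 K) in cofinite, π'.1.IsUnramifiedAt v :=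
    π'.1.hasSatakeParamAt_cofinite_holds
  filter_upwards [hcof, hE] with v hv hEv
  intro α hα i hi
  obtain ⟨β, hβ⟩ := hv
  -- the Satake parameter of `π` at `v` is `q_v^{(n-1)/2} β`
  have hα' := hasSatakeParamAt_map_cpow_of_twist hχ hW hW' hβ
  obtain rfl := AutomorphicRepData.hasSatakeParamAt_unique_holds π.1 hα hα'
  exact esymm_map_cpow_half_mem E NeZero.one_le hi (hEv β hβ i hi)

end Summit.Langlands.Langlands.Theorems.IrreducibleOffSector

end
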